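import Literature.AnabelianGeometry.EtaleTheta.TemperedFrobenioidProps

/-!
# [EtTh] §3: the constant-field category `D^cnst`, the functor `D₀ → D^cnst`, and the naturality
# clauses of Proposition 3.4 (ii) behind Theorem 3.7 (iii)

S. Mochizuki, *The étale theta function and its Frobenioid-theoretic manifestations*, Publ. RIMS **45**
(2009) [MochizukiEtTh2009], §3, PDF pp. 72, 74, 76, 79–80 (printed 298, 300, 302, 305–306).
Locators `p.N` = PDF page.

The setting of §3 (p.72, "the discussion preceding Definition 3.3"): "Write `B^temp(X^log)` for the
temperoid of tempered coverings of `X^log` …, `B(Spec(K))` for the Galois category of finite étale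
coverings of `Spec(K)`, and `D₀ := B^temp(X^log)⁰`; `D^cnst := B(Spec(K))⁰` — where the superscript '0'
denotes the full subcategory constituted by the connected objects …. Also, we observe that the natural
surjection `Π^tp_X ↠ G_K` determines a natural functor `D₀ → D^cnst` [cf. [FrdII], Example 1.3, (ii)]."

The statement files of this directory type `D₀` as an ABSTRACT category carrying the data of Def. 3.3
(iii) / 3.6 (i) (`DivisorMonoids`, `RealifiedDivisorMonoids`; owner abc-iut-L2-t3) and did not carry
`D^cnst`.  Consequently Theorem 3.7 (iii) — "the natural action of `Aut_C(A)` on `O^▷(A)` and `O^×(A)`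
factors through `Aut_{D^cnst}(A^cnst)` …, faithful[ly] if `Λ ∈ {ℤ, ℚ}`" — was typed
(`TemperedFrobenioid.Thm37_iii F`, `TemperedFrobenioidProps.lean`) through two FREE fields of the
hypothesis vocabulary `FrobenioidFacade` and is not provable for an arbitrary facade (cell GAP-LEDGER row
G-w5d164-1; sub-DAG `plan/L2/SUBDAG-EtTh-Thm37.md` rows (iii)/L10–L11).  This file supplies, additively
(no existing declaration is touched; the Def. 3.3 (iii) / 3.6 (i) structures have constructors in the
tree and stay as they are):

* the DATUM `cnst : D₀ ⥤ Dcnst` — `D^cnst` as an abstract category with the printed functor (in print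
  `Dcnst = B(Spec K)⁰ ≃ B(G_K)⁰`, `cnst` induced by `Π^tp_X ↠ G_K`; merge pass = instantiate with the
  temperoid / Galois-category side, TODO-merge(abc-iut-L3-t2, abc-iut-L1-t4));
* `RealifiedDivisorMonoids.Prop34Cnst T cnst` — the clauses of **Proposition 3.4 (ii)** relative to
  `D^cnst`, at the monoid type `Λ` of the Def. 3.6 (i) data, that the typed `DivisorMonoids.Prop34`
  omitted: (ii) asserts NATURAL isomorphisms `O_L^× ⥲ Ker(B₀(Y) → Φ₀^gp(Y))`,
  `O_L^▷ ⥲ B₀(Y) ×_{Φ₀^gp(Y)} Φ₀(Y)`, `L^× ⥲ F₀(Y)` for `Y` geometrically connected over the finite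
  extension `L` of `K` (`Spec L` = the image `Y^cnst` of `Y` in `D^cnst`); `Prop34` kept only
  "kernel / effective locus ⊆ constants" at the `B₀`-level.  Here: the effective locus of `B₀^Λ(Y)` lies
  in `F₀^Λ(Y)`; the pull-back action of `D₀`-morphisms on the constants `F₀^Λ` and on the log-divisors
  of constants depends only on their images in `D^cnst` (naturality of `L^× ⥲ F₀(Y)` in `Y`); and, for
  `Λ ∈ {ℤ, ℚ}`, automorphisms of `Y` acting identically on the kernel `(O_L^×)^Λ` have the same image in
  `Aut_{D^cnst}(Y^cnst)` (`Aut(L/K)` acts faithfully on `O_L^×`, resp. on its perfection — the content of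
  print's one-line proof "Assertion (iii) follows immediately from Proposition 3.4, (ii)", p.80).  As for
  `Prop34`, print PROVES these for the geometric data; over the abstract data they are what an instance
  must supply (a `Prop`-valued structure, assumed by name by discharges; its joint satisfiability with
  the rest of the interface stack is witnessed on the toy inhabitant in the proof-only companion);
* the INSTANTIATED facade `FrobenioidFacade.withCnst F K`: the two free fields of `F` replaced by the
  real predicates `FrobenioidFacade.AutActionFactorsThrough K` / `AutActionFaithful K` — "automorphisms
  of `A` with the same image under `Aut_C(A) → Aut_D(A_D) → Aut(K(A_D))` conjugate `O^▷(A)`, `O^×(A)`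
  identically" / "automorphisms conjugating `O^×(A)` identically have the same image" (the shape of the
  [FrdII] Thm. 1.2 (ii) twin `PadicFrd.Thm12_ii`, abc-iut-L1-t4), for any functor `K` on the base
  category (for a tempered Frobenioid: `K := (D → D₀) ⋙ cnst`).
The proof that `Thm37_iii` HOLDS at the instantiated facade under `Prop34Cnst` (and the toy witness of
`Prop34Cnst`) is the proof-only companion `Discharge/Sec3Thm37Cnst.lean`; this file is statements only.

v2 (owner, append-only; v1 declarations byte-identical): `DivisorMonoids.Prop34Cnst₀ dm cnst` — the
same naturality / faithfulness clauses at the level of the Def. 3.3 (iii) data `(Φ₀, B₀, B₀ → Φ₀^gp, F₀)`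
themselves (monoid type `ℤ`: `B₀^ℤ = B₀`, `F₀^ℤ = F₀`), i.e. exactly where `DivisorMonoids.Prop34` lives
and where a geometric instantiation proves them; the transport to the Def. 3.6 (i) data CONSTRUCTED from
`dm` (`RealifiedDivisorMonoids.ofRlfZ`, abc-iut-L6-t12) — `Prop34 ∧ Prop34Cnst₀ ⇒ Prop34Cnst (ofRlfZ dm)` —
is the proof-only companion `Discharge/Sec3Prop34CnstOfRlfZ.lean`.  HONEST FRAMING: refereed pre-IUT material ([EtTh] 2009);
definitions and a consistency witness only; nothing here bears on [IUTchIII] Cor. 3.12; typed ≠ proved.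
-/

namespace Literature.AnabelianGeometry.EtaleTheta

open CategoryTheory Opposite Literature.AlgebraicGeometry.Frobenioids

universe u₀ v₀ u₁ v₁ u v w

/-! ## Proposition 3.4 (ii) relative to `D^cnst` (pp.72, 74, 76) -/

namespace RealifiedDivisorMonoids

variable {D₀ : Type u₀} [Category.{v₀} D₀] {V : FrdIMonoidStub.{w}}

/-- **Proposition 3.4 (ii), naturality clauses relative to `D^cnst`, at monoid type `Λ`** (pp.74, 76;
the datum `cnst : D₀ ⥤ D^cnst` is "the natural functor `D₀ → D^cnst`" of p.72, `D^cnst := B(Spec(K))⁰`).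
Print: "(ii) Suppose that `Y^log → X^log` is a connected tempered covering such that the composite
morphism `Y^log → Spec(K)` factors through `Spec(L)`, for some finite extension `L` of `K`, in such a way
that `Y^log` is geometrically connected over `L` [i.e. `Spec L = Y^cnst`]. Then we have natural
isomorphisms of monoids `O_L^× ⥲ Ker(B₀(Y^log) → Φ₀^gp(Y^log)) ⊆ B₀(Y^log)`;
`O_L^▷ ⥲ B₀(Y^log) ×_{Φ₀^gp(Y^log)} Φ₀(Y^log)`; `L^× ⥲ F₀(Y^log) ⊆ B₀(Y^log)`", transported to the data
`B₀^Λ → (Φ₀^ℝ)^gp`, `F₀^Λ ⊆ B₀^Λ` of Def. 3.6 (i) (p.76: `B₀^Λ = B₀, B₀^pf, ℝ·Φ₀^birat`;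
`F₀^Λ = F₀, F₀^pf, ℝ·Φ₀^cnst`), and read as follows: the effective locus of `B₀^Λ(Y)` consists of
constants; the isomorphisms are NATURAL in `Y ∈ Ob(D₀)` — the pull-back action on constants and on
their log-divisors is the action of the images in `D^cnst`; and the induced action of
`Aut_{D^cnst}(Y^cnst) = Aut(L/K)` on `(O_L^×)^Λ` is faithful for `Λ ∈ {ℤ, ℚ}` (as used in the proof of
Theorem 3.7 (iii), p.80: "follows immediately from Proposition 3.4, (ii)").  A hypothesis structure on
the abstract data (print proves it for the geometric `Φ₀`, `B₀`), complementing `DivisorMonoids.Prop34`.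
[cite: MochizukiEtTh2009, Prop 3.4 (ii) p.74] -/
structure Prop34Cnst (T : RealifiedDivisorMonoids (D₀ := D₀) V) {Dcnst : Type u₁} [Category.{v₁} Dcnst]
    (cnst : D₀ ⥤ Dcnst) : Prop where
  /-- isomorphisms 1–2: an element of `B₀^Λ(Y)` whose image in `(Φ₀^ℝ)^gp(Y)` is effective [in
  particular, trivial] is constant: `(O_L^▷)^Λ = B₀^Λ(Y) ×_{(Φ₀^ℝ)^gp(Y)} Φ₀^ℝ(Y) ⊆ F₀^Λ(Y)` -/
  mem_FΛ_of_divΛ_eq_of : ∀ (Y : D₀ᵒᵖ) (b : T.BΛ.obj Y) (x : T.ΦR.obj Y),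
    T.divΛ Y b = Algebra.GrothendieckGroup.of x → b ∈ T.FΛ Y
  /-- isomorphism 3 is natural in `Y`: the pull-back action of morphisms of `D₀` on the constants
  `F₀^Λ ≅ (L^×)^Λ` factors through `D₀ → D^cnst` -/
  BΛ_map_eq_of_cnst_map_eq : ∀ {Y Y' : D₀} (g g' : Y ⟶ Y'), cnst.map g = cnst.map g' →
    ∀ b ∈ T.FΛ (op Y'), (T.BΛ.map g.op).hom b = (T.BΛ.map g'.op).hom b
  /-- … and so does the pull-back action on the (effective) log-divisors of constants, the elements of
  `Φ₀^ℝ(Y)` in the image of `(O_L^▷)^Λ` -/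
  ΦR_map_eq_of_cnst_map_eq : ∀ {Y Y' : D₀} (g g' : Y ⟶ Y'), cnst.map g = cnst.map g' →
    ∀ x : T.ΦR.obj (op Y'), (∃ b ∈ T.FΛ (op Y'), T.divΛ (op Y') b = Algebra.GrothendieckGroup.of x) →
      (T.ΦR.map g.op).hom x = (T.ΦR.map g'.op).hom x
  /-- for `Λ ∈ {ℤ, ℚ}`: automorphisms of `Y` acting identically on `Ker(B₀^Λ(Y) → (Φ₀^ℝ)^gp(Y)) ≅ (O_L^×)^Λ`
  have the same image in `Aut_{D^cnst}(Y^cnst)` (`Aut(L/K)` acts faithfully on `O_L^×`, resp. on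
  `(O_L^×)^pf`; Thm. 3.7 (iii), second clause) -/
  cnst_map_eq_of_BΛ_map_eq : T.Λ = MonoidType.Z ∨ T.Λ = MonoidType.Q →
    ∀ {Y : D₀} (g g' : Y ≅ Y), (∀ b : T.BΛ.obj (op Y), T.divΛ (op Y) b = 1 →
      (T.BΛ.map g.hom.op).hom b = (T.BΛ.map g'.hom.op).hom b) → cnst.map g.hom = cnst.map g'.hom

end RealifiedDivisorMonoids

/-! ## Theorem 3.7 (iii): the facade fields instantiated over a constant-field functor (pp.79–80) -/

namespace FrobenioidFacade

variable {D : Type u} [Category.{v} D] {Dc : Type u₁} [Category.{v₁} Dc]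

/-- **Theorem 3.7 (iii), first clause, as a real predicate** (p.79: "the natural action of `Aut_C(A)` on
`O^▷(A)` and `O^×(A)` factors through `Aut_{D^cnst}(A^cnst)`"), for a pre-Frobenioid `E : C → F_Φ` over
`D`, an object `A`, and a functor `K` on the base category (for a tempered Frobenioid
`K = (D → D₀ → D^cnst)`, so that `K(A_D) = A^cnst`): automorphisms `α, β` of `A` with the same image
under `Aut_C(A) → Aut_D(A_D) → Aut(K(A_D))` conjugate every element of `O^▷(A)`
(`PreFrobenioid.endSubmonoid`) and of `O^×(A)` (`PreFrobenioid.unitsSubgroup`) identically (conjugation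
`f ↦ α⁻¹ ∘ f ∘ α`, diagrammatic `α.inv ≫ f ≫ α.hom`, as in `ModelFrobenioid.autAction_factorsThroughBase`).
[cite: MochizukiEtTh2009, Thm 3.7 (iii) p.79] -/
def AutActionFactorsThrough (K : D ⥤ Dc) {Φ : Dᵒᵖ ⥤ CommMonCat.{w}} {C : Type (max u w)}
    [Category.{max v w} C] (E : C ⥤ ElemFrobenioid Φ) (A : C) : Prop :=
  ∀ α β : A ≅ A, K.map (PreFrobenioid.Base E α.hom) = K.map (PreFrobenioid.Base E β.hom) →
    (∀ f ∈ PreFrobenioid.endSubmonoid E A, α.inv ≫ f ≫ α.hom = β.inv ≫ f ≫ β.hom) ∧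
      ∀ u ∈ PreFrobenioid.unitsSubgroup E A, α.symm ≪≫ u ≪≫ α = β.symm ≪≫ u ≪≫ β

/-- **Theorem 3.7 (iii), second clause, as a real predicate** (p.80: "this factorization determines a
faithful action of the image of `Aut_C(A)` in `Aut_{D^cnst}(A^cnst)` on `O^▷(A)`, `O^×(A)`"):
automorphisms of `A` conjugating every element of `O^×(A)` identically [hence — `O^×(A) ⊆ O^▷(A)` — a
fortiori if they conjugate `O^▷(A)` identically] have the same image in `Aut(K(A_D))`.
[cite: MochizukiEtTh2009, Thm 3.7 (iii) p.80] -/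
def AutActionFaithful (K : D ⥤ Dc) {Φ : Dᵒᵖ ⥤ CommMonCat.{w}} {C : Type (max u w)}
    [Category.{max v w} C] (E : C ⥤ ElemFrobenioid Φ) (A : C) : Prop :=
  ∀ α β : A ≅ A, (∀ u ∈ PreFrobenioid.unitsSubgroup E A, α.symm ≪≫ u ≪≫ α = β.symm ≪≫ u ≪≫ β) →
    K.map (PreFrobenioid.Base E α.hom) = K.map (PreFrobenioid.Base E β.hom)

/-- **The facade with its Theorem 3.7 (iii) fields instantiated** over the constant-field functor `K` on
the base category: `AutActionFactorsThroughCnst := AutActionFactorsThrough K`,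
`AutActionFaithfulCnst := AutActionFaithful K`; every other field of `F` (the [FrdI] type predicates of
Thm. 3.7 (i)(ii)) is kept.  `Thm37_iii (F.withCnst K)` is then Theorem 3.7 (iii) with `D^cnst`, `A^cnst`
READ through `K` (merge pass of the markers TODO-merge(abc-iut-L3-t2 / abc-iut-L1-t4) of the two fields).
[cite: MochizukiEtTh2009, Thm 3.7 (iii) p.79] -/
def withCnst (F : FrobenioidFacade.{u, v, w} D) (K : D ⥤ Dc) : FrobenioidFacade.{u, v, w} D where
  IsOfUnitProfiniteType := F.IsOfUnitProfiniteType
  IsOfModelType := F.IsOfModelType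
  IsOfBiratFrobeniusNormalizedType := F.IsOfBiratFrobeniusNormalizedType
  IsOfStandardType := F.IsOfStandardType
  IsOfRationallyStandardType := F.IsOfRationallyStandardType
  AutActionFactorsThroughCnst E A := AutActionFactorsThrough K E A
  AutActionFaithfulCnst E A := AutActionFaithful K E A

/-- The instantiated first field, definitionally. [cite: MochizukiEtTh2009, Thm 3.7 (iii) p.79] -/
theorem withCnst_autActionFactorsThroughCnst (F : FrobenioidFacade.{u, v, w} D) (K : D ⥤ Dc)
    {Φ : Dᵒᵖ ⥤ CommMonCat.{w}} {C : Type (max u w)} [Category.{max v w} C]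
    (E : C ⥤ ElemFrobenioid Φ) (A : C) :
    (F.withCnst K).AutActionFactorsThroughCnst E A = AutActionFactorsThrough K E A := rfl

/-- The instantiated second field, definitionally. [cite: MochizukiEtTh2009, Thm 3.7 (iii) p.80] -/
theorem withCnst_autActionFaithfulCnst (F : FrobenioidFacade.{u, v, w} D) (K : D ⥤ Dc)
    {Φ : Dᵒᵖ ⥤ CommMonCat.{w}} {C : Type (max u w)} [Category.{max v w} C]
    (E : C ⥤ ElemFrobenioid Φ) (A : C) :
    (F.withCnst K).AutActionFaithfulCnst E A = AutActionFaithful K E A := rfl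

/-- The Thm. 3.7 (i)(ii) fields are those of `F`. [cite: MochizukiEtTh2009, Thm 3.7 p.79] -/
theorem withCnst_isOfUnitProfiniteType (F : FrobenioidFacade.{u, v, w} D) (K : D ⥤ Dc) :
    @IsOfUnitProfiniteType D _ (F.withCnst K) = @IsOfUnitProfiniteType D _ F := rfl

end FrobenioidFacade

namespace TemperedFrobenioid

variable {D₀ : Type u₀} [Category.{v₀} D₀] {V : FrdIMonoidStub.{w}}
  {T : RealifiedDivisorMonoids (D₀ := D₀) V} {D : Type u} [Category.{v} D]
  {VD : FrdICatStub.{u, v, w} D} (C₀ : TemperedFrobenioid T D VD)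
  {Dcnst : Type u₁} [Category.{v₁} Dcnst]

/-- `A ↦ A^cnst`: "Let `A ∈ Ob(C)`; `A_D := Base(A) ∈ Ob(D)`. Write `A^cnst ∈ Ob(D^cnst)` for the image
of `A_D` in `D^cnst`" (Thm. 3.7 (iii), p.79) — the composite functor `C → D → D₀ → D^cnst` of the
tempered Frobenioid over the datum `cnst`. [cite: MochizukiEtTh2009, Thm 3.7 (iii) p.79] -/
noncomputable abbrev cnstFunctor (cnst : D₀ ⥤ Dcnst) : C₀.category ⥤ Dcnst :=
  C₀.baseFunctorOfCategory ⋙ C₀.base ⋙ cnst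

/-- On morphisms `cnstFunctor` is `cnst ∘ (D → D₀) ∘ Base`. [cite: MochizukiEtTh2009, Thm 3.7 (iii) p.79] -/
theorem cnstFunctor_map (cnst : D₀ ⥤ Dcnst) {A B : C₀.category} (φ : A ⟶ B) :
    (C₀.cnstFunctor cnst).map φ = cnst.map (C₀.base.map (ModelFrobenioid.baseMap φ)) := rfl

end TemperedFrobenioid

/-! ## v2: the same clauses at the level of the Definition 3.3 (iii) data (pp.73–74) -/

namespace DivisorMonoids

variable {D₀ : Type u₀} [Category.{v₀} D₀]

/-- **Proposition 3.4 (ii), naturality clauses relative to `D^cnst`, for the data of Def. 3.3 (iii)**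
`(Φ₀, B₀, B₀ → Φ₀^gp, F₀)` themselves (pp.73–74) — the monoid type `ℤ` case `B₀^ℤ = B₀`, `F₀^ℤ = F₀`
of `RealifiedDivisorMonoids.Prop34Cnst`, stated where `DivisorMonoids.Prop34` lives: print's NATURAL
isomorphisms "`O_L^× ⥲ Ker(B₀(Y^log) → Φ₀^gp(Y^log))`, `O_L^▷ ⥲ B₀(Y^log) ×_{Φ₀^gp(Y^log)} Φ₀(Y^log)`,
`L^× ⥲ F₀(Y^log)`" (`Spec L = Y^cnst`, the image of `Y` under `cnst : D₀ → D^cnst = B(Spec(K))⁰`,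
p.72) read as: the pull-back action of morphisms of `D₀` on the constants `F₀` and on the log-divisors
of constants depends only on their images in `D^cnst`; and automorphisms of `Y` acting identically on
`Ker(B₀(Y) → Φ₀^gp(Y)) ≅ O_L^×` have the same image in `Aut_{D^cnst}(Y^cnst)` (`Aut(L/K)` acts
faithfully on `O_L^×` — the step of the proof of Thm. 3.7 (iii), p.80).  The effective-locus clauses
are `Prop34.ker_div₀_le_F₀` / `Prop34.mem_F₀_of_div₀_mem`.  A hypothesis structure on the abstract
data (print proves it for the geometric `Φ₀`, `B₀`); `Prop34 ∧ Prop34Cnst₀` transport to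
`RealifiedDivisorMonoids.Prop34Cnst` of the constructed Def. 3.6 (i) data `ofRlfZ dm`
(`Discharge/Sec3Prop34CnstOfRlfZ.lean`). [cite: MochizukiEtTh2009, Prop 3.4 (ii) p.74] -/
structure Prop34Cnst₀ (dm : DivisorMonoids.{u₀, v₀, w} D₀) {Dcnst : Type u₁} [Category.{v₁} Dcnst]
    (cnst : D₀ ⥤ Dcnst) : Prop where
  /-- `L^× ⥲ F₀(Y)` is natural in `Y`: the pull-back action of morphisms of `D₀` on the constant
  log-meromorphic functions `F₀` factors through `D₀ → D^cnst` -/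
  B₀_map_eq_of_cnst_map_eq : ∀ {Y Y' : D₀} (g g' : Y ⟶ Y'), cnst.map g = cnst.map g' →
    ∀ b ∈ dm.F₀ (op Y'), (dm.B₀.map g.op).hom b = (dm.B₀.map g'.op).hom b
  /-- … and so does the pull-back action on the (effective) log-divisors of constants, the elements of
  `Φ₀(Y)` in the image of `O_L^▷ ⊆ L^× = F₀(Y)` -/
  Φ₀_map_eq_of_cnst_map_eq : ∀ {Y Y' : D₀} (g g' : Y ⟶ Y'), cnst.map g = cnst.map g' →
    ∀ x : dm.Φ₀.obj (op Y'), (∃ b ∈ dm.F₀ (op Y'), dm.div₀ (op Y') b = Algebra.GrothendieckGroup.of x) →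
      (dm.Φ₀.map g.op).hom x = (dm.Φ₀.map g'.op).hom x
  /-- automorphisms of `Y` acting identically on `Ker(B₀(Y) → Φ₀^gp(Y)) ≅ O_L^×` have the same image in
  `Aut_{D^cnst}(Y^cnst)` (`Aut(L/K)` acts faithfully on `O_L^×`) -/
  cnst_map_eq_of_B₀_map_eq : ∀ {Y : D₀} (g g' : Y ≅ Y), (∀ b : dm.B₀.obj (op Y),
    dm.div₀ (op Y) b = 1 → (dm.B₀.map g.hom.op).hom b = (dm.B₀.map g'.hom.op).hom b) →
      cnst.map g.hom = cnst.map g'.hom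

end DivisorMonoids

end Literature.AnabelianGeometry.EtaleTheta
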